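import Literature.MathematicalPhysics.QuantumFieldTheory.Balaban1983to89.B8CubeMemberTorusClasses
import Literature.MathematicalPhysics.QuantumFieldTheory.Balaban1983to89.B8CubeMemberTorusDomainsDented
import Literature.MathematicalPhysics.QuantumFieldTheory.Balaban1983to89.B8Ineq159FlatDentedCubeMemberPrinted

/-!
# `Balaban1983to89.B8DentedCubeMemberTorusClasses` — TRANSPLANT STEP T3c ON THE DENTED CUBE MEMBER of [Balaban1985Variational] (148)–(150): THE CONSTRAINT
# CLASSES AND LEVELS OF THE TORUS READING AT `D = cubeTDomainsDented …` — `(Ω′_j)^{(j)}`, «inside Ω′_{j+1}», the bond class `𝔅` of [Balaban1984PropagatorsII] (2.3)∕(2.20)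
# (`B6SectADomainsV1.Domains.LamBond` of r03's `domT`) versus NODE 00's dented tower `CubeB8D.sq`, cells `CubeB8D.lamS` and print's class `CubeB8D.lamBP`, under the chart
# and the shift `t`

statement-level skeleton of published theorems with citation tags; proofs where landed; nothing here is a claim about the
Yang–Mills mass gap

`[Balaban1984PropagatorsII]` ("B6", CMP **96** (1984) 223–250) (2.1)–(2.4) p. 224 («Ω_j = B^j(Ω_j^{(j)})», «Λ_j = Ω_j^{(j)} ∖ B(Ω_{j+1}^{(j+1)})»), (2.3) p. 224 (the bonds
of `B(Λ_j)`), (2.20) p. 226; `[Balaban1985RegularSpaces]` ("B8" = [6], CMP **99** (1985) 75–102) (1.31) p. 82, (1.131) p. 99, p. 98, (1.3)–(1.4) p. 77;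
`[Balaban1985Variational]` ("[15]", CMP **102** (1985) 277–309) (148)–(150) p. 301 («Ω′_j = □_j, j = 0, 1, …, k − 1», the top member cut back to `□_k ∩ Ω_k`), p. 300.
PDF held: `paper:balaban1985-cmp99-regular-spaces-gauge-fixing`, `paper:balaban1985-cmp102-variational-background`, `paper:balaban1984-cmp96-propagators-rt-ii`.

CITATION HEADER (lean-in-tree rule).  Cell `pub-ymgap` (YM Track A, HUMAN RULING D-0062), DAG node N05 = [B8], seat `pub-ymgap-dag-n05-e` (g32; FAN-OUT §N05 row s3b,
Proposition-6 lane; piece (d2-b) of the (β) road: dag-n05-c PRICE I.41357, STANDING GO on the dented twins of their lineage I.42366; this seat INTENT I.43297).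
WHY THIS FILE.  dag-n05-c's `B8CubeMemberTorusClasses` (T3c) is the dictionary between the torus reading's domain datum `domT hN D hk` at the PURE member
`D = cubeTDomainsL0 …` and print's `□_j^{(j)}`, `□_{j+1}^{(j)}`, `cubeLamBP`; its §1–§2 (coarse labels, `shiftJ`, `blockMap_labels_sub_shift`, `mem_cube_iff_blockMap`) are generic
and are IMPORTED here by name.  THIS FILE is the member-specific §3–§4 RE-READ at the DENTED member `D = B8CubeMemberTorusDomainsDented.cubeTDomainsDented …` (p659647), whose
top domain is `t + (□_k ∩ Ω_k)`: `(Ω′_j)^{(j)}` acquires at `j = k` the clause «the `k`-block lies in `Ω_k`» (read on coarse labels through the datum's block law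
`CubeB8D.blocks`, [6] (1.3)), «deep» at `j = k − 1` the same clause one level down (the `(k−1)`-cell reading and the `k`-block reading agree by block saturation), and the
class `𝔅` becomes this seat's `CubeB8D.lamBP` (p659892) — so that the Landau transfer, the size lines and the transplant of (1.59) ((d2-c), next files) are token re-keys of
dag-n05-c's T3d∕T4.

WHAT THIS FILE PROVES (kernel-checked; `L = ℓ + 1 ≥ 2`; a dented datum `c : Node00.CubeB8D (d+1) (ℓ+1) K Ω` at the top truncation `n = c.k`; side conditions `M_h·L ∣ c.ρ`,
`M_h·L ∣ c.M`, `R·(M_h·L) ≤ c.ρ`, `M_h ≥ 2`; host `P ≥ boxP`, `hN`, `hk : c.k ≤ m + K`; the chart-frame premise `hΩ` of `cubeTDomainsDented`).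
* §1 the block law on labels: `mem_omega_iff_inTop_blockMap` (`w ∈ Ω_k ⇔` the `k`-block label of `w` is `inTop`), `blockMap_natMul_smul`, `under_blockMap_iff_under`
  (the `(k−1)`-cell and `k`-block readings of «lies in `Ω_k`» agree), ★ `mem_sq_iff_blockMap` (`w ∈ c.sq j ⇔ blockMap (Lʲ) w ∈ □_j^{(j)} ∧ (j = k → inTop)`),
  `inBox_of_mem_lamS`, `mem_sq_one_iff` (`Ω′₁` on level-`0` labels), ★ `not_mem_sq_one_of_mem_lamS_zero` (a level-`0` cell is not a site of `Ω′₁`; at `k = 1` the dent).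
* §2 ★ `mem_Om_iff` (`(Ω′_j)^{(j)}` of `domT` = `t_j +` the `j`-labels of `c.sq j`, with the `Ω_k` clause at `j = k`), `Om_eq_empty_of_lt`, ★ `deep_iff_of_lt` (with the `Ω_k`
  clause at `j + 1 = k`), `not_deep_top`, `deep_zero_iff` (`Deep 0 y ⇔ labels y − t ∈ c.sq 1`), `labelsJ_bounds_of_mem_Om`, `labelsJ_tgt_of_lamBond`, ★★ `lamBond_iff`
  (`𝔅` of the reading ⇔ `CubeB8D.lamBP c j`, `1 ≤ j ≤ k`), `lamBond_zero_iff` (level `0`: both ends off `t + Ω′₁`), `lamSite_iff` (`Λ_j` of the reading ⇔ `c.lamS j`).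
* §3 `len_blkV1_member` (the weight of a fine bond is `L^{levD}`), `le_levD_labels_iff`, `levD_labels_le`.

HONEST SCOPE ∕ NOT CLAIMED.  Bookkeeping; no estimate.  Count-neutral; N05 ∕ N07 NOT discharged; one finite `T⁴` programme at fixed `ε`, Bałaban as printed; nothing
continuum ∕ ℝ⁴ ∕ OS ∕ mass-gap ∕ Clay.  No `sorry`, no `def`, no `instance`, no `notation`.  Unit `pub-ymgap-dag-n05-e` (g32), 2026-08-28.

RELATED IN THE TREE, NOT DUPLICATED (`rg -l 'DentedCubeMemberTorus' Balaban1983to89` = 0, 2026-08-28T21:50Z): T3c `B8CubeMemberTorusClasses` (dag-n05-c g12; the PURE member —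
§1–§2 USED by name, §3–§4 are the model of this file), `B8CubeMemberTorusDomainsDented` (this seat g31; `cubeTDomainsDented`, `levD`, `le_lev_toBox_iff` USED),
`Node00.CubeB8D` ∕ `.sq` ∕ `.lamS` ∕ `.inTop` ∕ `.blocks` (p655171; USED), `CubeB8D.lamBP` (p659892; USED).
-/
noncomputable section

namespace Literature.MathematicalPhysics.QuantumFieldTheory.Balaban1983to89.B8DentedCubeMemberTorusClasses

open B4Reflection242 (boxDom mem_boxDom blk)
open B6MultiLevelBoxOperator (N0 bigSide)
open B6GlobalChartV1 (PV toBox toBox_apply)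
open B6GlobalChartV1L0 (domT blkV1 iterBlockOf_mem_domT_iff)
open B7Prop1Explicit (e e_apply)
open B7Prop1Local (InBox)
open B8Ineq132 (Under)
open B8Eq131Cubes (gs cube sqLo sqHi inLo inHi bLo bHi)
open B8Eq131CubesAdmissible (cubeFam cubeFam_false_of_le)
open B8Eq191FlatLettersCubeMember (under_iff_blockMap_eq)
open B8CubeMemberBoxDomains (shift boxP)
open B8CubeMemberTorusDomainsDented (cubeTDomainsDented levD levD_le le_levD_iff le_lev_toBox_iff)
open B8CubeMemberTorusChart (toTorus labels labels_eq_toBox toTorus_labels labels_nonneg labels_lt shift_eq_toTorus labels_toTorus)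
open B8CubeMemberTorusAverages (labelsJ labelsJ_zero exists_iterBlockOf_eq pow_mul_labelsJ_succ_le)
open B8CubeMemberTorusClasses (labelsJ_iterBlockOf labelsJ_blockOf labelsJ_shift_of_lt shiftJ shift_eq_smul_shiftJ blockMap_sub_smul blockMap_labels_sub_shift
  inBox_blowup_iff_blockMap mem_cube_iff_blockMap)
open B8Ineq159FlatDentedCubeMemberPrinted (mem_lamBP_iff)
open Node00 (CubeB8D)
open B5Eq118OneStroke (iterBlockOf iterBlockOf_zero iterBlockOf_succ val_iterBlockOf)
open Literature.MathematicalPhysics.QuantumLattice (blockMap)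
open B7BlockGeometry (blockMap_blockMap)

variable {d ℓ mV KV : ℕ} {hd : 1 ≤ d + 1} {hL : Odd (ℓ + 1) ∧ 1 < ℓ + 1}

/-! ## §1 The block law of the dented datum read on labels -/

section Blocks

variable {K : ℕ} {Ω : ℕ → Set (Fin (d + 1) → ℤ)} (c : CubeB8D (d + 1) (ℓ + 1) K Ω)

/-- **`w ∈ Ω_k` IFF THE `k`-BLOCK OVER ITS `Lᵏ`-LABEL LIES IN `Ω_k`** («Ω_k = Bᵏ(Ω_k^{(k)})», the datum's block law `CubeB8D.blocks` read through `Under`).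
[cite: Balaban1985RegularSpaces, (1.3)∕(1.6) p.77; Balaban1984PropagatorsII, (2.1) p.224] -/
theorem mem_omega_iff_inTop_blockMap (w : Fin (d + 1) → ℤ) : w ∈ Ω c.k ↔ c.inTop (blockMap ((ℓ + 1) ^ c.k) w) := by
  have hL1 : 1 ≤ ℓ + 1 := Nat.succ_pos ℓ
  constructor
  · intro hw x hx
    rw [under_iff_blockMap_eq hL1] at hx
    exact c.blocks hx.symm hw
  · intro h
    exact h w ((under_iff_blockMap_eq hL1 c.k _ w).2 rfl)

/-- `blockMap N (N • z) = z` (`N ≥ 1`). [folklore] [cite: Balaban1984PropagatorsI, (1.6) p.18, dictionary] -/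
theorem blockMap_natMul_smul {N : ℕ} (hN : 0 < N) (z : Fin (d + 1) → ℤ) : blockMap N ((N : ℤ) • z) = z := by
  have h := blockMap_sub_smul (d := d) hN 0 (-z)
  rw [smul_neg, sub_neg_eq_add, zero_add] at h
  rw [h]
  funext i
  simp [blockMap]

/-- **THE `(k−1)`-CELL AND THE `k`-BLOCK READINGS OF «LIES IN `Ω_k`» AGREE** (`j + 1 = k`): every fine site under the level-`j` label `z` lies in `Ω_k` iff every
fine site under the level-`(j+1)` label `blockMap L z` does — by the block law `CubeB8D.blocks` ([6] (1.3)).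
[cite: Balaban1985RegularSpaces, (1.3)∕(1.6) p.77; Balaban1985Variational, (148)–(150) p.301] -/
theorem under_blockMap_iff_under {j : ℕ} (hj : j + 1 = c.k) (z : Fin (d + 1) → ℤ) :
    (∀ x, Under (ℓ + 1) (j + 1) (blockMap (ℓ + 1) z) x → x ∈ Ω c.k) ↔ ∀ x, Under (ℓ + 1) j z x → x ∈ Ω c.k := by
  have hL1 : 1 ≤ ℓ + 1 := by omega
  have hLj : 0 < (ℓ + 1) ^ j := pow_pos (by omega) j
  have hpow : (ℓ + 1) ^ c.k = (ℓ + 1) ^ j * (ℓ + 1) := by rw [← hj, pow_succ]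
  constructor
  · intro h x hx
    rw [under_iff_blockMap_eq hL1] at hx
    refine h x ((under_iff_blockMap_eq hL1 (j + 1) _ x).2 ?_)
    rw [pow_succ, ← blockMap_blockMap, hx]
  · intro h x hx
    rw [under_iff_blockMap_eq hL1, pow_succ, ← blockMap_blockMap] at hx
    -- the fine corner `Lʲ·z` lies under `z`, hence in `Ω_k`; it has the same `k`-block as `x`
    have h0 : (((ℓ + 1) ^ j : ℕ) : ℤ) • z ∈ Ω c.k :=
      h _ ((under_iff_blockMap_eq hL1 j z _).2 (blockMap_natMul_smul hLj z))
    refine c.blocks ?_ h0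
    rw [hpow, ← blockMap_blockMap, ← blockMap_blockMap, blockMap_natMul_smul hLj, hx]

/-- ★ **THE DENTED TOWER READ ON `Lʲ`-BLOCK LABELS**: for `j ≤ k`, `w ∈ c.sq j ⇔ blockMap (Lʲ) w ∈ □_j^{(j)} ∧ (j = k → inTop (blockMap (Lʲ) w))` — `Ω′_j = □_j` below the top
(p. 98 «□_j is a sum of the big blocks of the lattice T_{L^{−j}}»), `Ω′_k = □_k ∩ Ω_k` with `Ω_k = Bᵏ(Ω_k^{(k)})`.
[cite: Balaban1985Variational, (148)–(150) p.301; Balaban1985RegularSpaces, p.98, (1.131) p.99, (1.3) p.77] -/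
theorem mem_sq_iff_blockMap {j : ℕ} (hjk : j ≤ c.k) (w : Fin (d + 1) → ℤ) :
    w ∈ c.sq j ↔ InBox (sqLo (ℓ + 1) c.a c.ρ c.k j) (sqHi (ℓ + 1) c.a c.M c.ρ c.k j) (blockMap ((ℓ + 1) ^ j) w) ∧
      (j = c.k → ∀ x, Under (ℓ + 1) j (blockMap ((ℓ + 1) ^ j) w) x → x ∈ Ω c.k) := by
  have hL1 : 1 ≤ ℓ + 1 := Nat.succ_pos ℓ
  show w ∈ cubeFam false (ℓ + 1) c.a c.M c.ρ c.k j ∩ {x | j = c.k → x ∈ Ω c.k} ↔ _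
  rw [Set.mem_inter_iff, cubeFam_false_of_le _ c.a c.M c.ρ hjk, mem_cube_iff_blockMap hL1, Set.mem_setOf_eq]
  refine and_congr Iff.rfl (forall_congr' fun hj => ?_)
  subst hj
  exact mem_omega_iff_inTop_blockMap c w

/-- A cell of `Λ′_j` is a label of `□_j^{(j)}`. [cite: Balaban1985RegularSpaces, (1.131) p.99 («Λ′_j = □_j^{(j)} ∖ □_{j+1}^{(j)}»); Balaban1985Variational, (148) p.301] -/
theorem inBox_of_mem_lamS {j : ℕ} {z : Fin (d + 1) → ℤ} (hz : z ∈ c.lamS j) :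
    InBox (sqLo (ℓ + 1) c.a c.ρ c.k j) (sqHi (ℓ + 1) c.a c.M c.ρ c.k j) z := by
  by_cases hjk : j ≤ c.k
  · simp only [Node00.CubeB8D.lamS, if_pos hjk, Set.mem_setOf_eq] at hz
    exact hz.1
  · simp only [Node00.CubeB8D.lamS, if_neg hjk] at hz
    exact absurd hz (Set.notMem_empty _)

/-- **`Ω′₁` READ ON LEVEL-`0` LABELS**: `y ∈ c.sq 1 ⇔ y ∈ □₁` (the blow-up box `[inLo 0, inHi 0]` of `□₁^{(1)}`) and, when `k = 1`, `y ∈ Ω₁` — the latter in the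
level-`0` cell reading «every fine site under the `0`-label `y`» of `CubeB8D.lamS ∕ lamBP` (equal to the `1`-block reading by `under_blockMap_iff_under`).
[cite: Balaban1985Variational, (148)–(150) p.301; Balaban1985RegularSpaces, (1.131) p.99, (1.3) p.77] -/
theorem mem_sq_one_iff (y : Fin (d + 1) → ℤ) :
    y ∈ c.sq 1 ↔ InBox (inLo (ℓ + 1) c.a c.ρ c.k 0) (inHi (ℓ + 1) c.a c.M c.ρ c.k 0) y ∧ (0 + 1 = c.k → ∀ x, Under (ℓ + 1) 0 y x → x ∈ Ω c.k) := by
  have hk := c.one_le_k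
  rw [mem_sq_iff_blockMap c hk, pow_one]
  obtain ⟨e1, e2⟩ := B8Eq131Cubes.inner_eq_blowup (L := ℓ + 1) c.a c.M c.ρ hk
  rw [e1, e2, inBox_blowup_iff_blockMap (L := ℓ + 1) (by omega)]
  refine and_congr Iff.rfl ?_
  constructor
  · intro h h01
    rw [← under_blockMap_iff_under c h01]
    exact h (by omega)
  · intro h h1
    rw [under_blockMap_iff_under c (by omega)]
    exact h (by omega)

/-- ★ **A LEVEL-`0` CELL OF THE DENTED TOWER IS NOT A SITE OF `Ω′₁`** («Λ′₀ = Ω′₀ ∖ Ω′₁»): for `k ≥ 2` this is [6]'s `□₀ ∖ □₁`; for `k = 1` the cell condition excludes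
exactly the sites of `□₁` lying in `Ω₁`. [cite: Balaban1985RegularSpaces, (1.131) p.99, (1.5) p.77; Balaban1985Variational, (148)–(150) p.301; Balaban1984PropagatorsII, (2.3) p.224 («Λ₀ = Ω₁ᶜ»)] -/
theorem not_mem_sq_one_of_mem_lamS_zero {z : Fin (d + 1) → ℤ} (hz : z ∈ c.lamS 0) : z ∉ c.sq 1 := by
  have hk := c.one_le_k
  intro h1
  simp only [Node00.CubeB8D.lamS, if_pos (Nat.zero_le c.k), Set.mem_setOf_eq] at hz
  exact hz.2.2 (by omega) ((mem_sq_one_iff c z).1 h1)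

end Blocks

/-! ## §2 `(Ω′_j)^{(j)}`, «deep», `𝔅` and `Λ_j` of `domT` at the dented member -/

section Member

variable {Mh K : ℕ} {Ω : ℕ → Set (Fin (d + 1) → ℤ)} (hℓ : 1 ≤ ℓ) (hMh : 2 ≤ Mh) (c : CubeB8D (d + 1) (ℓ + 1) K Ω) {R : ℕ}
  (hρ : Mh * (ℓ + 1) ∣ c.ρ) (hM : Mh * (ℓ + 1) ∣ c.M) (hR : R * (Mh * (ℓ + 1)) ≤ c.ρ)
  {P : Fin (d + 1) → ℕ} (hfit : ∀ μ, boxP ℓ c.M c.ρ c.k c.k μ ≤ P μ)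
  (hΩ : ∀ y y' : Fin (d + 1) → ℤ, blk (bigSide ℓ Mh c.k) y' = blk (bigSide ℓ Mh c.k) y →
    (y - shift ℓ Mh c.a c.ρ c.k c.k ∈ Ω c.k ↔ y' - shift ℓ Mh c.a c.ρ c.k c.k ∈ Ω c.k))
  (hN : ∀ μ, N0 ℓ Mh c.k P μ = (PV d ℓ mV KV hd hL).sitesPerDir 0) (hk : c.k ≤ mV + KV)

/-- ★ **`(Ω′_j)^{(j)}` OF THE TORUS READING AT THE DENTED MEMBER** (`1 ≤ j ≤ k`): a coarse site `y` of `T^{(j)}` belongs to `(domT hN D hk).Om j` for `D = cubeTDomainsDented …`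
iff `labelsJ y − t_j ∈ □_j^{(j)}` and, at `j = k`, the `k`-block over `labelsJ y − t_k` lies in `Ω_k` — the top domain is `t + (□_k ∩ Ω_k)`.
[cite: Balaban1984PropagatorsII, (2.1) p.224 («Ω_j = B^j(Ω_j^{(j)})»); Balaban1985Variational, (148)–(150) p.301; Balaban1985RegularSpaces, p.98, (1.131) p.99] -/
theorem mem_Om_iff {j : ℕ} (hj1 : 1 ≤ j) (hjk : j ≤ c.k) (y : Site (PV d ℓ mV KV hd hL) j) :
    y ∈ (domT hN (cubeTDomainsDented hℓ hMh c hρ hM hR P hfit hΩ) hk).Om j ↔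
      InBox (sqLo (ℓ + 1) c.a c.ρ c.k j) (sqHi (ℓ + 1) c.a c.M c.ρ c.k j) (labelsJ y - shiftJ ℓ Mh c.a c.ρ c.k c.k j) ∧
        (j = c.k → ∀ x, Under (ℓ + 1) j (labelsJ y - shiftJ ℓ Mh c.a c.ρ c.k c.k j) x → x ∈ Ω c.k) := by
  have hj : j ≤ mV + KV := hjk.trans hk
  obtain ⟨x, rfl⟩ := exists_iterBlockOf_eq hj y
  rw [iterBlockOf_mem_domT_iff hN _ hk hjk x, le_lev_toBox_iff hℓ hMh c hρ hM hR hfit hΩ hN hj1 hjk x, mem_sq_iff_blockMap c hjk,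
    ← blockMap_labels_sub_shift c.a hj hjk le_rfl x]
  rfl

/-- `(Ω′_j)^{(j)} = ∅` above the top (`k < j`). [cite: Balaban1984PropagatorsII, (2.1) p.224, dictionary] -/
theorem Om_eq_empty_of_lt {j : ℕ} (hj : c.k < j) :
    (domT hN (cubeTDomainsDented hℓ hMh c hρ hM hR P hfit hΩ) hk).Om j = ∅ :=
  (domT hN (cubeTDomainsDented hℓ hMh c hρ hM hR P hfit hΩ) hk).Om_eq_empty hj

/-- ★ **«DEEP» IS «INSIDE `t_j + (Ω′_{j+1})^{(j)}`»** (`j < k`): `Deep j y ⇔ labelsJ y − t_j ∈ □_{j+1}^{(j)}` and, at `j + 1 = k`, every fine site under the `(k−1)`-label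
`labelsJ y − t_{k−1}` lies in `Ω_k` (the `(k−1)`-cell reading of «the block lies in `Ω′_k = □_k ∩ Ω_k`», equal to the `k`-block reading by `under_blockMap_iff_under`).
[cite: Balaban1984PropagatorsII, (2.3)–(2.4) p.224 («Λ_j = Ω_j^{(j)} ∖ B(Ω_{j+1}^{(j+1)})»); Balaban1985Variational, (148)–(150) p.301; Balaban1985RegularSpaces, (1.131) p.99] -/
theorem deep_iff_of_lt {j : ℕ} (hjk : j < c.k) (y : Site (PV d ℓ mV KV hd hL) j) :
    (domT hN (cubeTDomainsDented hℓ hMh c hρ hM hR P hfit hΩ) hk).Deep j y ↔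
      InBox (inLo (ℓ + 1) c.a c.ρ c.k j) (inHi (ℓ + 1) c.a c.M c.ρ c.k j) (labelsJ y - shiftJ ℓ Mh c.a c.ρ c.k c.k j) ∧
        (j + 1 = c.k → ∀ x, Under (ℓ + 1) j (labelsJ y - shiftJ ℓ Mh c.a c.ρ c.k c.k j) x → x ∈ Ω c.k) := by
  have hj1 : j + 1 ≤ mV + KV := by omega
  have hL1 : 1 ≤ ℓ + 1 := Nat.succ_pos ℓ
  show blockOf y ∈ _ ↔ _
  rw [mem_Om_iff hℓ hMh c hρ hM hR hfit hΩ hN hk (j := j + 1) (by omega) hjk, labelsJ_blockOf hj1]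
  obtain ⟨h1, h2⟩ := B8Eq131Cubes.inner_eq_blowup (L := ℓ + 1) c.a c.M c.ρ hjk
  rw [h1, h2, inBox_blowup_iff_blockMap (L := ℓ + 1) (by omega)]
  have hs : shiftJ ℓ Mh c.a c.ρ c.k c.k j = ((ℓ + 1 : ℕ) : ℤ) • shiftJ ℓ Mh c.a c.ρ c.k c.k (j + 1) := by
    funext i
    simp only [shiftJ, Pi.smul_apply, smul_eq_mul]
    have e1 : (ℓ + 1) ^ (c.k + 1 - j) = (ℓ + 1) * (ℓ + 1) ^ (c.k + 1 - (j + 1)) := by rw [← pow_succ']; congr 1; omega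
    have e2 : (ℓ + 1) ^ (c.k - j) = (ℓ + 1) * (ℓ + 1) ^ (c.k - (j + 1)) := by rw [← pow_succ']; congr 1; omega
    rw [e1, e2]
    push_cast
    ring
  rw [hs, blockMap_sub_smul (N := ℓ + 1) (by omega)]
  refine and_congr Iff.rfl (forall_congr' fun hj => ?_)
  -- `j + 1 = k`: the clause of `mem_Om_iff` at the top is the `k`-block reading; convert it to the `(k−1)`-cell reading
  rw [← under_blockMap_iff_under c hj, blockMap_sub_smul (N := ℓ + 1) (by omega)]

/-- nothing is deep at the top level `k`. [cite: Balaban1984PropagatorsII, (2.3) p.224 («Λ_k = Ω_k^{(k)}»), dictionary] -/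
theorem not_deep_top (y : Site (PV d ℓ mV KV hd hL) c.k) : ¬ (domT hN (cubeTDomainsDented hℓ hMh c hρ hM hR P hfit hΩ) hk).Deep c.k y := by
  show blockOf y ∉ _
  rw [Om_eq_empty_of_lt hℓ hMh c hρ hM hR hfit hΩ hN hk (Nat.lt_succ_self c.k)]
  exact Finset.notMem_empty _

/-- **AT LEVEL `0`, «DEEP» IS «IN `t + Ω′₁`»**: `Deep 0 y ⇔ labels y − t ∈ c.sq 1` (`= □₁` for `k ≥ 2`, `= □₁ ∩ Ω₁` for `k = 1` — the dent then lies at level `0`).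
[cite: Balaban1984PropagatorsII, (2.3) p.224 («Λ₀ = Ω₁ᶜ»); Balaban1985RegularSpaces, (1.131) p.99 («Λ′₀ = T ∖ □₁»); Balaban1985Variational, (150) p.301] -/
theorem deep_zero_iff (y : Site (PV d ℓ mV KV hd hL) 0) :
    (domT hN (cubeTDomainsDented hℓ hMh c hρ hM hR P hfit hΩ) hk).Deep 0 y ↔ labels y - shift ℓ Mh c.a c.ρ c.k c.k ∈ c.sq 1 := by
  show blockOf y ∈ _ ↔ _
  have h := iterBlockOf_mem_domT_iff hN (cubeTDomainsDented hℓ hMh c hρ hM hR P hfit hΩ) hk c.one_le_k y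
  rw [iterBlockOf_succ, iterBlockOf_zero] at h
  rw [h, le_lev_toBox_iff hℓ hMh c hρ hM hR hfit hΩ hN le_rfl c.one_le_k y]
  rfl

/-- **A SITE OF `(Ω′_j)^{(j)}` IS AWAY FROM THE SEAM OF THE COARSE TORUS** (`1 ≤ j ≤ k`): `1 ≤ labelsJ y μ` and `labelsJ y μ + 2 ≤ N∕Lʲ` — its block lies in `t + □_j ⊂ t + □₀`,
which is `ρLᵏ`-deep, and `ρLᵏ ≥ 2Lʲ`. [cite: Balaban1984PropagatorsII, (2.1) p.224; Balaban1985RegularSpaces, p.98, dictionary] -/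
theorem labelsJ_bounds_of_mem_Om {j : ℕ} (hj1 : 1 ≤ j) (hjk : j ≤ c.k) {y : Site (PV d ℓ mV KV hd hL) j}
    (hy : y ∈ (domT hN (cubeTDomainsDented hℓ hMh c hρ hM hR P hfit hΩ) hk).Om j) (μ : Fin (d + 1)) :
    1 ≤ labelsJ y μ ∧ labelsJ y μ + 2 ≤ ((PV d ℓ mV KV hd hL).sitesPerDir j : ℕ) := by
  have hj : j ≤ mV + KV := hjk.trans hk
  have hMh1 : 1 ≤ Mh := le_trans (by norm_num) hMh
  have hρ0 : 0 < c.ρ := lt_of_lt_of_le (Nat.succ_pos ℓ) c.L_le_ρ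
  have hρL : ℓ + 1 ≤ c.ρ := c.L_le_ρ
  obtain ⟨x, rfl⟩ := exists_iterBlockOf_eq hj y
  -- the fine site `x` lies over `y`, and its translate is in `Ω′_j ⊂ □_j ⊂ □₀`
  have hlev := (iterBlockOf_mem_domT_iff hN _ hk hjk x).1 hy
  have hsq := (le_lev_toBox_iff hℓ hMh c hρ hM hR hfit hΩ hN hj1 hjk x).1 hlev
  have hcube : (fun μ => ((x μ).val : ℤ)) - shift ℓ Mh c.a c.ρ c.k c.k ∈ cube (ℓ + 1) c.a c.M c.ρ c.k j := c.sq_subset_cube hjk hsq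
  have hcube0 : (fun μ => ((x μ).val : ℤ)) - shift ℓ Mh c.a c.ρ c.k c.k ∈ cube (ℓ + 1) c.a c.M c.ρ c.k 0 :=
    B8Eq131Cubes.cube_anti (Nat.zero_le j) hjk hcube
  have hdeep := B8CubeMemberTorusDomainsL0.siteDeep_shift_of_mem_cube_zero hℓ hMh c.a c.one_le_k le_rfl hfit hcube0 μ
  rw [sub_add_cancel] at hdeep
  obtain ⟨h1, h2⟩ := hdeep
  rw [hN μ] at h2
  -- `ρLᵏ ≥ 2Lʲ`
  have hLj : 0 < (ℓ + 1) ^ j := pow_pos (Nat.succ_pos ℓ) j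
  have hw : 2 * (ℓ + 1) ^ j ≤ c.ρ * (ℓ + 1) ^ c.k := by
    have g1 : 2 * (ℓ + 1) ^ j ≤ 2 * (ℓ + 1) ^ c.k := Nat.mul_le_mul_left _ (Nat.pow_le_pow_right (Nat.succ_pos ℓ) hjk)
    have g2 : 2 * (ℓ + 1) ^ c.k ≤ c.ρ * (ℓ + 1) ^ c.k := Nat.mul_le_mul_right _ (by omega)
    exact g1.trans g2
  -- the period of `T^{(j)}` is `N ∕ Lʲ`
  have hNj : ((PV d ℓ mV KV hd hL).sitesPerDir 0 : ℕ) = (ℓ + 1) ^ j * (PV d ℓ mV KV hd hL).sitesPerDir j := by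
    simp only [Params.sitesPerDir, Nat.sub_zero]
    show 2 * (ℓ + 1) ^ (mV + KV) = (ℓ + 1) ^ j * (2 * (ℓ + 1) ^ (mV + KV - j))
    rw [mul_left_comm, ← pow_add, Nat.add_sub_cancel' hj]
  have hval := val_iterBlockOf j hj x μ
  -- integer-division arithmetic, in `ℕ`
  have hx1 : (ℓ + 1) ^ j * ((iterBlockOf j x) μ).val ≤ (x μ).val := by
    rw [hval, mul_comm]; exact Nat.div_mul_le_self _ _
  have hx2 : (x μ).val < (ℓ + 1) ^ j * (((iterBlockOf j x) μ).val + 1) := by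
    have h := Nat.lt_div_mul_add (a := (x μ).val) hLj
    have hv : ((iterBlockOf j x) μ).val = (x μ).val / (ℓ + 1) ^ j := hval
    rw [hv, mul_add, mul_one, mul_comm]
    exact h
  have h1n : c.ρ * (ℓ + 1) ^ c.k ≤ (x μ).val := by exact_mod_cast h1
  have h2n : (x μ).val + c.ρ * (ℓ + 1) ^ c.k ≤ (ℓ + 1) ^ j * (PV d ℓ mV KV hd hL).sitesPerDir j := by rw [← hNj]; exact_mod_cast h2
  have hc1 : 1 ≤ ((iterBlockOf j x) μ).val := by
    by_contra h0
    push Not at h0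
    have : (ℓ + 1) ^ j * (((iterBlockOf j x) μ).val + 1) ≤ (ℓ + 1) ^ j * 1 := Nat.mul_le_mul_left _ (by omega)
    omega
  have hc2 : ((iterBlockOf j x) μ).val + 2 ≤ (PV d ℓ mV KV hd hL).sitesPerDir j := by
    have : (ℓ + 1) ^ j * (((iterBlockOf j x) μ).val + 2) ≤ (ℓ + 1) ^ j * (PV d ℓ mV KV hd hL).sitesPerDir j := by nlinarith
    exact Nat.le_of_mul_le_mul_left this hLj
  simp only [labelsJ]
  exact ⟨by exact_mod_cast hc1, by exact_mod_cast hc2⟩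

/-- **ON A BOND OF `𝔅` THE COARSE TARGET LABEL IS THE SOURCE LABEL PLUS `e_μ`** (`1 ≤ j ≤ k`; no wrap-around, by `labelsJ_bounds_of_mem_Om`).
[cite: Balaban1984PropagatorsII, (2.3) p.224, (2.20) p.226, dictionary] -/
theorem labelsJ_tgt_of_lamBond {j : ℕ} (hj1 : 1 ≤ j) (hjk : j ≤ c.k) {b : PBond (PV d ℓ mV KV hd hL) j}
    (hb : (domT hN (cubeTDomainsDented hℓ hMh c hρ hM hR P hfit hΩ) hk).LamBond j b) : labelsJ b.tgt = labelsJ b.src + e b.dir := by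
  obtain ⟨hends, -, -⟩ := hb
  rcases hends with hsrc | htgt
  · have h := labelsJ_bounds_of_mem_Om hℓ hMh c hρ hM hR hfit hΩ hN hk hj1 hjk hsrc b.dir
    exact labelsJ_shift_of_lt b.src b.dir (by omega)
  · -- the target is away from the seam, so the source label is the target label minus one
    have h := labelsJ_bounds_of_mem_Om hℓ hMh c hρ hM hR hfit hΩ hN hk hj1 hjk htgt b.dir
    refine labelsJ_shift_of_lt b.src b.dir ?_
    -- `labelsJ (src.shift dir) dir = (labelsJ src dir + 1) mod N_j ≥ 1` rules out the wrap
    have hval : ((b.tgt b.dir).val : ℤ) = (((b.src b.dir).val + 1 : ℕ) : ℤ) % ((PV d ℓ mV KV hd hL).sitesPerDir j : ℕ) := by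
      show (((b.src.shift b.dir) b.dir).val : ℤ) = _
      simp only [Site.shift, Function.update_self]
      rw [ZMod.val_add, ZMod.val_one]
      push_cast
      rfl
    have hlt : ((b.src b.dir).val : ℤ) < ((PV d ℓ mV KV hd hL).sitesPerDir j : ℕ) := by exact_mod_cast ZMod.val_lt _
    have h1 : (1 : ℤ) ≤ ((b.tgt b.dir).val : ℤ) := h.1
    simp only [labelsJ]
    by_contra hge
    push Not at hge
    have heq : ((b.src b.dir).val : ℤ) + 1 = ((PV d ℓ mV KV hd hL).sitesPerDir j : ℕ) := by omega
    rw [hval] at h1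
    push_cast at h1
    rw [heq, Int.emod_self] at h1
    exact absurd h1 (by norm_num)

/-- ★★ **THE BOND CLASS `𝔅` OF THE TORUS READING AT THE DENTED MEMBER IS PRINT's CLASS `CubeB8D.lamBP`** (`1 ≤ j ≤ k`): a coarse bond `b` of `T^{(j)}` is a `LamBond` of
`domT hN D hk`, `D = cubeTDomainsDented …`, iff `(labelsJ b₋ − t_j, dir b) ∈ c.lamBP j` — inner bonds of `Λ′_j` AND the crossing bonds of (1.31)∕[B6] (2.3), on the dented
sequence `{Ω′_j}` (the bonds over the dent `□_k ∖ Ω_k` are level-`(k−1)` members). [cite: Balaban1984PropagatorsII, (2.3) p.224, (2.20) p.226; Balaban1985RegularSpaces, (1.31) p.82, (1.131) p.99; Balaban1985Variational, (148)–(150) p.301] -/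
theorem lamBond_iff {j : ℕ} (hj1 : 1 ≤ j) (hjk : j ≤ c.k) (b : PBond (PV d ℓ mV KV hd hL) j) (htgt : labelsJ b.tgt = labelsJ b.src + e b.dir) :
    (domT hN (cubeTDomainsDented hℓ hMh c hρ hM hR P hfit hΩ) hk).LamBond j b ↔
      (labelsJ b.src - shiftJ ℓ Mh c.a c.ρ c.k c.k j, b.dir) ∈ c.lamBP j := by
  rw [mem_lamBP_iff]
  unfold B6SectADomainsV1.Domains.LamBond
  rw [mem_Om_iff hℓ hMh c hρ hM hR hfit hΩ hN hk hj1 hjk, mem_Om_iff hℓ hMh c hρ hM hR hfit hΩ hN hk hj1 hjk, htgt]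
  have hsub : labelsJ b.src + e b.dir - shiftJ ℓ Mh c.a c.ρ c.k c.k j = labelsJ b.src - shiftJ ℓ Mh c.a c.ρ c.k c.k j + e b.dir := by abel
  rw [hsub]
  simp only
  rcases Nat.lt_or_ge j c.k with hlt | hge
  · rw [deep_iff_of_lt hℓ hMh c hρ hM hR hfit hΩ hN hk hlt, deep_iff_of_lt hℓ hMh c hρ hM hR hfit hΩ hN hk hlt, htgt, hsub]
    exact ⟨fun ⟨h1, h2, h3⟩ => ⟨hjk, h1, fun _ => ⟨h2, h3⟩⟩, fun ⟨_, h1, h23⟩ => ⟨h1, (h23 hlt).1, (h23 hlt).2⟩⟩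
  · have hjk' : j = c.k := le_antisymm hjk hge
    subst hjk'
    have hn1 := not_deep_top hℓ hMh c hρ hM hR hfit hΩ hN hk b.src
    have hn2 := not_deep_top hℓ hMh c hρ hM hR hfit hΩ hN hk b.tgt
    exact ⟨fun ⟨h1, _, _⟩ => ⟨le_rfl, h1, fun h => absurd h (lt_irrefl _)⟩, fun ⟨_, h1, _⟩ => ⟨h1, hn1, hn2⟩⟩

/-- **THE LEVEL-`0` CLASS OF THE TORUS READING AT THE DENTED MEMBER**: a fine bond is a level-`0` `LamBond` iff NEITHER end lies in `t + Ω′₁` (`Ω₀ = T_η`, «Λ₀ = Ω₁ᶜ»;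
`Ω′₁ = □₁` for `k ≥ 2`, `= □₁ ∩ Ω₁` for `k = 1`). [cite: Balaban1984PropagatorsII, (2.3) p.224 («Λ₀ = Ω₁ᶜ»), (2.6)∕(2.20) p.224∕226; Balaban1985RegularSpaces, (1.131) p.99 («Λ′₀ = T ∖ □₁»); Balaban1985Variational, (150) p.301] -/
theorem lamBond_zero_iff (b : PBond (PV d ℓ mV KV hd hL) 0) :
    (domT hN (cubeTDomainsDented hℓ hMh c hρ hM hR P hfit hΩ) hk).LamBond 0 b ↔
      labels b.src - shift ℓ Mh c.a c.ρ c.k c.k ∉ c.sq 1 ∧ labels b.tgt - shift ℓ Mh c.a c.ρ c.k c.k ∉ c.sq 1 := by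
  unfold B6SectADomainsV1.Domains.LamBond
  rw [deep_zero_iff hℓ hMh c hρ hM hR hfit hΩ hN hk, deep_zero_iff hℓ hMh c hρ hM hR hfit hΩ hN hk]
  have h0 : b.src ∈ (domT hN (cubeTDomainsDented hℓ hMh c hρ hM hR P hfit hΩ) hk).Om 0 := by
    rw [(domT hN (cubeTDomainsDented hℓ hMh c hρ hM hR P hfit hΩ) hk).Om_zero]; exact Finset.mem_univ _
  exact ⟨fun ⟨_, h1, h2⟩ => ⟨h1, h2⟩, fun ⟨h1, h2⟩ => ⟨Or.inl h0, h1, h2⟩⟩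

/-- **THE CELLS `Λ_j` OF THE TORUS READING AT THE DENTED MEMBER ARE NODE 00's `CubeB8D.lamS`** (`1 ≤ j ≤ k`): `LamSite j y ⇔ labelsJ y − t_j ∈ c.lamS j`.
[cite: Balaban1984PropagatorsII, (2.3)–(2.4) p.224; Balaban1985Variational, (148) p.301, (152) p.301; Balaban1985RegularSpaces, (1.131) p.99] -/
theorem lamSite_iff {j : ℕ} (hj1 : 1 ≤ j) (hjk : j ≤ c.k) (y : Site (PV d ℓ mV KV hd hL) j) :
    (domT hN (cubeTDomainsDented hℓ hMh c hρ hM hR P hfit hΩ) hk).LamSite j y ↔ labelsJ y - shiftJ ℓ Mh c.a c.ρ c.k c.k j ∈ c.lamS j := by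
  unfold B6SectADomainsV1.Domains.LamSite
  rw [mem_Om_iff hℓ hMh c hρ hM hR hfit hΩ hN hk hj1 hjk]
  simp only [Node00.CubeB8D.lamS, if_pos hjk, Set.mem_setOf_eq]
  rcases Nat.lt_or_ge j c.k with hlt | hge
  · rw [deep_iff_of_lt hℓ hMh c hρ hM hR hfit hΩ hN hk hlt]
    exact ⟨fun ⟨⟨h1, h2⟩, h3⟩ => ⟨h1, h2, fun _ => h3⟩, fun ⟨h1, h2, h3⟩ => ⟨⟨h1, h2⟩, h3 hlt⟩⟩
  · have hjk' : j = c.k := le_antisymm hjk hge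
    subst hjk'
    have hn1 := not_deep_top hℓ hMh c hρ hM hR hfit hΩ hN hk y
    exact ⟨fun ⟨⟨h1, h2⟩, _⟩ => ⟨h1, h2, fun h => absurd h (lt_irrefl _)⟩, fun ⟨h1, h2, _⟩ => ⟨⟨h1, h2⟩, hn1⟩⟩

/-! ## §3 The level of a bond's block -/

/-- **THE WEIGHT OF A FINE BOND IS `L^{lev}` WITH `lev = levD (labels b₋)`** (`B8Ineq159MultiLevelTorusL0.len_blkV1` at the dented member).
[cite: Balaban1984PropagatorsII, (2.45)–(2.46) p.231; Balaban1985RegularSpaces, p.86 («|A|₍α₎ = sup_j sup_{Ω_j}(Lʲη)^{−α}|A|»); Balaban1985Variational, (150) p.301] -/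
theorem len_blkV1_member (b : PBond (PV d ℓ mV KV hd hL) 0) :
    (B6Geom246MultiLevelTorusL0.geomT (cubeTDomainsDented hℓ hMh c hρ hM hR P hfit hΩ)).len
        (blkV1 hN (cubeTDomainsDented hℓ hMh c hρ hM hR P hfit hΩ) b) =
      ((ℓ : ℝ) + 1) ^ levD Mh c (labels b.src) := by
  rw [B8Ineq159MultiLevelTorusL0.len_blkV1 hN]
  rfl

end Member

/-- **THE LEVEL OF A FINE SITE**: `j ≤ levD (labels x) ⇔ labels x − t ∈ c.sq j` for `1 ≤ j ≤ k`. [cite: Balaban1984PropagatorsII, (2.3)–(2.4) p.224; Balaban1985Variational, (148)–(150) p.301] -/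
theorem le_levD_labels_iff {Mh K : ℕ} {Ω : ℕ → Set (Fin (d + 1) → ℤ)} (c : CubeB8D (d + 1) (ℓ + 1) K Ω) {j : ℕ} (hj1 : 1 ≤ j) (hjk : j ≤ c.k)
    (x : Site (PV d ℓ mV KV hd hL) 0) :
    j ≤ levD Mh c (labels x) ↔ labels x - shift ℓ Mh c.a c.ρ c.k c.k ∈ c.sq j :=
  le_levD_iff Mh c hj1 hjk _

/-- `levD (labels x) ≤ k`. [cite: Balaban1984PropagatorsII, (2.3)–(2.4) p.224, dictionary] -/
theorem levD_labels_le {Mh K : ℕ} {Ω : ℕ → Set (Fin (d + 1) → ℤ)} (c : CubeB8D (d + 1) (ℓ + 1) K Ω) (x : Site (PV d ℓ mV KV hd hL) 0) :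
    levD Mh c (labels x) ≤ c.k :=
  levD_le Mh c _

end Literature.MathematicalPhysics.QuantumFieldTheory.Balaban1983to89.B8DentedCubeMemberTorusClasses
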